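import Mathlib
import Summits.NavierStokesRegularity.NavierStokesRegularity.Theorems.ThreadingFluxPlatonicSelectionLemma
import Summits.NavierStokesRegularity.NavierStokesRegularity.Theorems.ThreadingFluxPlatonicWindowGlueGeneral
import HarnessLib

/-!
# Crux `PoloidalLiouville` (stmt-NavierStokesRegularity-1222, wall W1), crux idea «platonic-germ-sieve» (ns-idea-15 g11, critic V27):
# THE SELECTION LEMMA FOR EVERY ROTATION CLASS PRESERVING NO AXIS (tetrahedral, octahedral, icosahedral, …)

Support file (`--supports stmt-NavierStokesRegularity-1222`, helper; cell `ns-wall-extremal`, width hand ns-wall-eng-7 g10; 0 kit).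
`ThreadingFluxPlatonicSelectionLemma.lean` (p726901) proves the custodian's Selection Lemma for O-invariant leads through the cube's
generators.  Here the same statement is proved for an ARBITRARY set `G` of rotations of `ℝ³` (linear isometries preserving the cross product,
the rotation data of ns-wall-eng-8 g7's `…PlatonicWindowGlueGeneral`, p727166) with `PreservesNoAxis G`:

* ★ `Platonic.invariantHarmonic_eq_zero_of_zonal_of_rotations` — a `G`-invariant real solid harmonic of degree `l ≥ 1` infinitesimally zonal
  about some `n ≠ 0` is `0`: its zonal-axis set `{c | DA(x)[c × x] ≡ 0}` is a SUBSPACE of `ℝ³`, non-zero, and `G`-stable (transport along the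
  rotations), hence all of `ℝ³` by eng-8's `submodule_eq_top_of_stable` (BY NAME); then `x × ∇A ≡ 0` and `eq_zero_of_radial_harmonic` (p726901).
* ★★ `Platonic.selectionLemma_of_rotations` — for such `G`, a `G`-invariant real solid harmonic `h ≠ 0` of degree `l₀ ≥ 1` and ANY real solid
  harmonic `Y` of degree `l ≥ 1` with `⟪y, ∇h(y) × ∇Y(y)⟫ ≡ 0`: `l ≠ l₀ ⇒ Y = 0`, `l = l₀ ⇒ Y = c·h` (`Zonal.mixedDegreeBracketRigidity` p690637,
  `LoopLaw.sameDegreeBracketRigidity` p684047, BY NAME).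

READING for the card: RESULTS v7 §7 (iv) «icosahedral class … not run» — the Selection Lemma (UNIFORM-MECHANISM part (i)) holds for the
icosahedral and tetrahedral rotation classes as soon as their rotation data and `PreservesNoAxis` are supplied (the custodian's call, as for
p727166); the cascade itself (part (ii), first contact, the I₁₅ slot structure over ℚ(√5)) is untouched.  Nothing here is an NS statement.

HONEST FRAME: harmonic-polynomial algebra, information-grade, strictly below W1; W1 movement 0; `OctahedralCentreRigidity`,
`PoloidalLiouville` (1222), `UnthreadedRigidity` (27585) and NS regularity are OPEN — NOT proved.  [folklore]
-/

-- the summit and its single sub-problem share the name (CONVENTIONS §1)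
set_option linter.dupNamespace false

noncomputable section

namespace Summit.NavierStokesRegularity.NavierStokesRegularity.Theorems.PoloidalLiouville.Platonic

open MvPolynomial
open scoped RealInnerProductSpace
open Literature.Analysis.FluidPDE (cross)
open Summit.NavierStokesRegularity.NavierStokesRegularity.Theorems.PoloidalLiouville.CentreJet (E3)
open Summit.NavierStokesRegularity.NavierStokesRegularity.Theorems.PoloidalLiouville.HorizonTower
  (cross_fin3 inner_gradient_eq_fderiv)
open Summit.NavierStokesRegularity.NavierStokesRegularity.Theorems.PoloidalLiouville.HorizonTower.Zonal
  (evalE lapP evalE_zero evalE_X evalE_sub evalE_mul fderiv_evalE_apply differentiable_evalE laplacian_evalE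
    eq_zero_of_evalE_eq_zero mixedDegreeBracketRigidity)
open Summit.NavierStokesRegularity.NavierStokesRegularity.Theorems.PoloidalLiouville.LoopLaw (sameDegreeBracketRigidity)

/-- ★ **A solid harmonic invariant under a rotation class preserving no axis is zonal about no axis.**  `G` a set of rotations of `ℝ³`
(linear isometries preserving `×`) with `PreservesNoAxis G`; `A` homogeneous of degree `l ≥ 1`, `ΔA = 0`, `G`-invariant, and
`⟪n × x, ∇A(x)⟫ = 0` for all `x` with `n ≠ 0` ⇒ `A = 0`. -/
theorem invariantHarmonic_eq_zero_of_zonal_of_rotations {G : Set (E3 → E3)}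
    (hGrot : ∀ g ∈ G, ∃ L : E3 ≃ₗᵢ[ℝ] E3, (∀ x, L x = g x) ∧ ∀ u v, L (cross u v) = cross (L u) (L v))
    (hGaxis : PreservesNoAxis G) (l : ℕ) (A : MvPolynomial (Fin 3) ℝ) (hl : 1 ≤ l)
    (hA : A.IsHomogeneous l ∧ ∀ y : E3, Laplacian.laplacian (evalE A) y = 0)
    (hinv : ∀ g ∈ G, ∀ x, evalE A (g x) = evalE A x)
    {n : E3} (hn : n ≠ 0) (hzonal : ∀ x : E3, ⟪cross n x, gradient (evalE A) x⟫ = 0) : A = 0 := by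
  obtain ⟨hAh, hAlap⟩ := hA
  have hlin : ∀ (c₁ c₂ : E3) (a b : ℝ) (y : E3), cross (a • c₁ + b • c₂) y = a • cross c₁ y + b • cross c₂ y := fun c₁ c₂ a b y => by
    ext i; fin_cases i <;> simp [cross, crossProduct]
  -- the zonal-axis set as a subspace
  let V : Submodule ℝ E3 :=
    { carrier := {c | ∀ x : E3, fderiv ℝ (evalE A) x (cross c x) = 0}
      zero_mem' := fun x => by
        have : cross (0 : E3) x = 0 := by ext i; fin_cases i <;> simp [cross, crossProduct]
        show fderiv ℝ (evalE A) x (cross 0 x) = 0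
        rw [this, map_zero]
      add_mem' := fun {c₁ c₂} h₁ h₂ x => by
        have h := hlin c₁ c₂ 1 1 x
        simp only [one_smul] at h
        rw [h, map_add, h₁ x, h₂ x, add_zero]
      smul_mem' := fun a c hc x => by
        have h := hlin c c a 0 x
        simp only [zero_smul, add_zero] at h
        show fderiv ℝ (evalE A) x (cross (a • c) x) = 0
        rw [h, map_smul, hc x, smul_zero] }
  have hnV : n ∈ V := fun x => by rw [← inner_gradient_eq_fderiv, real_inner_comm]; exact hzonal x
  have hV : V ≠ ⊥ := fun h => hn (by simpa [h] using hnV)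
  -- `G`-stability: transport along a rotation symmetry of `A`
  have hstab : ∀ g ∈ G, ∀ c ∈ V, g c ∈ V := by
    intro g hg c hc y
    obtain ⟨L, hL, hLcross⟩ := hGrot g hg
    obtain ⟨x, rfl⟩ := L.surjective y
    rw [← hL, ← hLcross]
    -- chain rule on `A ∘ L = A`
    have hcomp : HasFDerivAt (fun z => evalE A (L z)) ((fderiv ℝ (evalE A) (L x)).comp (L : E3 →L[ℝ] E3)) x :=
      (differentiable_evalE A (L x)).hasFDerivAt.comp x (L : E3 →L[ℝ] E3).hasFDerivAt
    have hfun : (fun z => evalE A (L z)) = evalE A := funext fun z => by rw [hL]; exact hinv g hg z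
    rw [hfun] at hcomp
    have hD := hcomp.fderiv
    have := congrArg (fun M : E3 →L[ℝ] ℝ => M (cross c x)) hD
    simp only [ContinuousLinearMap.comp_apply] at this
    rw [hc x] at this
    exact this.symm
  have hGiso : ∀ g ∈ G, ∃ L : E3 ≃ₗᵢ[ℝ] E3, ∀ x, L x = g x := fun g hg => by
    obtain ⟨L, hL, -⟩ := hGrot g hg; exact ⟨L, hL⟩
  have htop : V = ⊤ := submodule_eq_top_of_stable hGiso hGaxis V hV hstab
  have hrot : ∀ c x : E3, fderiv ℝ (evalE A) x (cross c x) = 0 := fun c => by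
    have hc : c ∈ V := by rw [htop]; exact Submodule.mem_top
    exact hc
  -- the three polynomial rotation generators vanish (as in p726901)
  set e : Fin 3 → E3 := fun i => EuclideanSpace.single i (1 : ℝ) with he
  have hr0 : X 1 * pderiv 2 A - X 2 * pderiv 1 A = 0 := by
    refine eq_zero_of_evalE_eq_zero fun x => ?_
    have h := hrot (e 0) x
    rw [fderiv_evalE_cross] at h
    simp [he] at h
    simp only [evalE_sub, evalE_mul, evalE_X]
    linear_combination h
  have hr1 : X 2 * pderiv 0 A - X 0 * pderiv 2 A = 0 := by
    refine eq_zero_of_evalE_eq_zero fun x => ?_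
    have h := hrot (e 1) x
    rw [fderiv_evalE_cross] at h
    simp [he] at h
    simp only [evalE_sub, evalE_mul, evalE_X]
    linear_combination h
  have hr2 : X 0 * pderiv 1 A - X 1 * pderiv 0 A = 0 := by
    refine eq_zero_of_evalE_eq_zero fun x => ?_
    have h := hrot (e 2) x
    rw [fderiv_evalE_cross] at h
    simp [he] at h
    simp only [evalE_sub, evalE_mul, evalE_X]
    linear_combination h
  have hlapA : lapP A = 0 := eq_zero_of_evalE_eq_zero fun y => by rw [← laplacian_evalE]; exact hAlap y
  exact eq_zero_of_radial_harmonic hl hAh hlapA hr0 hr1 hr2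

/-- ★★ **THE SELECTION LEMMA FOR EVERY ROTATION CLASS PRESERVING NO AXIS.**  `G` rotations of `ℝ³` with `PreservesNoAxis G`; `h` a
`G`-invariant real solid harmonic of degree `l₀ ≥ 1`, `h ≠ 0`; `Y` ANY real solid harmonic of degree `l ≥ 1` with
`⟪y, ∇h(y) × ∇Y(y)⟫ = 0` for all `y`.  Then `Y = 0` if `l ≠ l₀` and `Y ∈ ℝ·h` if `l = l₀`. -/
theorem selectionLemma_of_rotations {G : Set (E3 → E3)}
    (hGrot : ∀ g ∈ G, ∃ L : E3 ≃ₗᵢ[ℝ] E3, (∀ x, L x = g x) ∧ ∀ u v, L (cross u v) = cross (L u) (L v))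
    (hGaxis : PreservesNoAxis G) (l₀ l : ℕ) (h Y : MvPolynomial (Fin 3) ℝ) (hl₀ : 1 ≤ l₀) (hl : 1 ≤ l)
    (hh : h.IsHomogeneous l₀ ∧ ∀ y : E3, Laplacian.laplacian (evalE h) y = 0)
    (hY : Y.IsHomogeneous l ∧ ∀ y : E3, Laplacian.laplacian (evalE Y) y = 0)
    (hh0 : h ≠ 0) (hinv : ∀ g ∈ G, ∀ x, evalE h (g x) = evalE h x)
    (hbr : ∀ y : E3, ⟪y, cross (gradient (evalE h) y) (gradient (evalE Y) y)⟫ = 0) :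
    (l ≠ l₀ → Y = 0) ∧ (l = l₀ → ∃ c : ℝ, Y = c • h) := by
  refine ⟨fun hne => ?_, fun heq => ?_⟩
  · by_contra hY0
    obtain ⟨n, hn, hzon, -⟩ := mixedDegreeBracketRigidity l₀ l h Y hl₀ hl (Ne.symm hne) hh hY hh0 hY0 hbr
    exact hh0 (invariantHarmonic_eq_zero_of_zonal_of_rotations hGrot hGaxis l₀ h hl₀ hh hinv hn hzon)
  · subst heq
    exact sameDegreeBracketRigidity l h Y hl₀ hh hY hh0 hbr

end Summit.NavierStokesRegularity.NavierStokesRegularity.Theorems.PoloidalLiouville.Platonic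

end
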